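import Mathlib
import HarnessLib
import Summits.HubbardSuperconductivity.HubbardSuperconductivity.Theorems.KLProgrammeKLRegimeEngineLastStepAliasRowsSqrt

/-!
# K3 gen-8-FLOW (stmt 20437, stub (C), «(C)-B-ALIAS-L» / pen (R204)(4) «(C)-B-ALIAS-ROWS-GENERAL»): THE VOLUME ARITHMETIC OF THE GENERAL-STEP
# (B) DOOR'S ALIAS GROUPS at `Md = 28` — abstract pieces

Cell gate-hubbard-kl, seat p2 g20.  The (B) door of record at the flow frames `K_m → K_{m+1}`, `m ≤ n_β − 1`
(`…SupFlowTablesGN.norm_iteratedFDeriv_klLocSelfEnergyRe_flowFrame_sub_le_aliasing_gevrey_numeral4`, p593193) bounds `‖Dʲ(symbol difference)(q)‖` by a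
MAIN term (frame distance × tower input) plus two ALIAS GROUPS: the tree group `4·(2(2(X·(3ʲ·D_d·(2/N)^{Md−j−4}·S))) + L²Lʲ·(A_d·(X′/(1+L/4)^s)))`
(`X = 2|β|L²Sj²`, `X′ = 2|β|L²Ss²`, `D_d = P₆(Md!)²ρ₁^{Md} + P₂(Md!)²ρ₂^{Md}`, `P₆ + P₂ = 64|βL²|/Λ_m`) and the dressing group
`2·2·([a-alias + a-far] + [b-alias + b-far])` (prefactors `P_a = 48δ²/Λ_m`, `P_b = 48δ/Λ_m`, moments `Sj′, Ss′`), with the four ratios of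
`…EngineAliasVolume` (all `≤ 2^31·E·16^m`).  This file is the `Md = 28` analogue of `…LastStepAliasArith/RowsCore` (one more spent derivative than the last
step's `26`, to absorb the tree group's `1/Λ_m ≤ 32·4^m`):

* §1 `aliasTerm28_le` (`a(28!)²ρ²⁸r^{28−j−4} ≤ a(28!)²B⁸ε²⁰`), `gevreyRow28_le_of_le` (`(28!)²B⁸ε²⁰ ≤ S⁸U²⁰/(2^60β⁴)` for `E ≤ 2^11S`);
* §2 prefactors: `genPrefA_le` (`P_a ≤ 3/32`), `genPrefB_le` (`P_b ≤ 12`), `genTreePref_eq` (`P₆ + P₂ = 2^11·4^m·|c|`);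
* §3 the six pieces: `genTreeAlias_le` (`≤ 2^27·4^m·Nj²·Q` from `X·(P₆+P₂) ≤ 2^12·4^m·Nj²`), `genTreeFar_le` (`≤ 2^24·4^m·Ns²·Xv⁴`),
  `genJaAlias_le` (`≤ 2^10·Q`), `genJaFar_le` (`≤ 2^7·Xv⁴`), `genJbAlias_le` (`≤ 2^21·Nj′·Q`), `genJbFar_le` (`≤ 2^18·Ns′·Xv⁴`), and their `0 ≤` twins.

Pure real arithmetic; no definitions; nothing about the model's sizes is asserted; nothing asserts superconductivity.
References: BGM 2006 §2.3 (2.21)–(2.24) [cite: BenfattoGiulianiMastropietro2006].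
-/

noncomputable section

namespace Summit.HubbardSuperconductivity.HubbardSuperconductivity.Theorems.EngineV8

set_option linter.dupNamespace false -- summit = problem name (single-conjunct summit), D-0017

open Real Finset
open Summit.HubbardSuperconductivity.HubbardSuperconductivity.Theorems.KLRegimeSplit
open Summit.HubbardSuperconductivity.HubbardSuperconductivity.Theorems.KLProgrammeLegKernels
open scoped Nat

/-! ## §1 The order-28 row price -/

/-- **The `j`-uniform Gevrey-row bound at `Md = 28`**: `a·(28!)²·ρ²⁸·r^{28−j−4} ≤ a·(28!)²·B⁸·ε²⁰` for `j ≤ 4`, from `ρ·r ≤ ε`, `ρ ≤ B`, `0 ≤ r ≤ 1`.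
[cite: BenfattoGiulianiMastropietro2006, §2.3 (2.24)] -/
theorem aliasTerm28_le {a ρ r ε B : ℝ} (ha : 0 ≤ a) (hρ0 : 0 ≤ ρ) (hr0 : 0 ≤ r) (hr1 : r ≤ 1) (hρr : ρ * r ≤ ε) (hρB : ρ ≤ B)
    {j : ℕ} (hj : j ≤ 4) :
    a * ((28 ! : ℝ)) ^ 2 * ρ ^ 28 * r ^ (28 - j - 4) ≤ a * ((28 ! : ℝ)) ^ 2 * B ^ 8 * ε ^ 20 := by
  have h1 : r ^ (28 - j - 4) ≤ r ^ 20 := pow_le_pow_of_le_one hr0 hr1 (by omega)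
  have h3 : ρ ^ 8 ≤ B ^ 8 := pow_le_pow_left₀ hρ0 hρB 8
  have h4 : (ρ * r) ^ 20 ≤ ε ^ 20 := pow_le_pow_left₀ (mul_nonneg hρ0 hr0) hρr 20
  have ha2 : 0 ≤ a * ((28 ! : ℝ)) ^ 2 := by positivity
  calc a * ((28 ! : ℝ)) ^ 2 * ρ ^ 28 * r ^ (28 - j - 4) ≤ a * ((28 ! : ℝ)) ^ 2 * ρ ^ 28 * r ^ 20 :=
        mul_le_mul_of_nonneg_left h1 (by positivity)
    _ = a * ((28 ! : ℝ)) ^ 2 * (ρ ^ 8 * (ρ * r) ^ 20) := by ring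
    _ ≤ a * ((28 ! : ℝ)) ^ 2 * (B ^ 8 * ε ^ 20) :=
        mul_le_mul_of_nonneg_left (mul_le_mul h3 h4 (by positivity) ((pow_nonneg hρ0 8).trans h3)) ha2
    _ = a * ((28 ! : ℝ)) ^ 2 * B ^ 8 * ε ^ 20 := by ring

/-- **THE ORDER-28 ROW PRICE**: `E ≤ 2^11·S`, `0 ≤ E`: `(28!)²·(2^22Eβ²)⁸·(U/(2^26β))²⁰ ≤ S⁸·U²⁰/(2^60·β⁴)` (`(28!)² ≤ 2^196`, `klBetaMin ≤ β`).
[cite: BenfattoGiulianiMastropietro2006, §2.3 (2.24)] -/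
theorem gevreyRow28_le_of_le {β U E S : ℝ} (hβ : klBetaMin ≤ β) (hE0 : 0 ≤ E) (hE : E ≤ 2 ^ 11 * S) :
    ((28 ! : ℝ)) ^ 2 * (2 ^ 22 * E * β ^ 2) ^ 8 * (U / (2 ^ 26 * β)) ^ 20 ≤ S ^ 8 * U ^ 20 / (2 ^ 60 * β ^ 4) := by
  have h128 : (128 : ℝ) ≤ β := by simpa [klBetaMin] using hβ
  have hβ0 : (0 : ℝ) < β := by linarith
  have hfac : ((28 ! : ℝ)) ^ 2 ≤ 2 ^ 196 := by norm_num [Nat.factorial]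
  have hE8 : E ^ 8 ≤ (2 ^ 11 * S) ^ 8 := pow_le_pow_left₀ hE0 hE 8
  have heq : ((28 ! : ℝ)) ^ 2 * (2 ^ 22 * E * β ^ 2) ^ 8 * (U / (2 ^ 26 * β)) ^ 20 =
      (((28 ! : ℝ)) ^ 2 * E ^ 8 / (2 ^ 172 * 2 ^ 172)) * (U ^ 20 / β ^ 4) := by
    rw [div_pow, mul_pow, mul_pow]
    field_simp
  have heq2 : S ^ 8 * U ^ 20 / (2 ^ 60 * β ^ 4) = (S ^ 8 / 2 ^ 60) * (U ^ 20 / β ^ 4) := by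
    rw [mul_comm (2 ^ 60 : ℝ) (β ^ 4), ← div_div, mul_div_assoc, div_mul_eq_mul_div, mul_div_assoc]
  rw [heq, heq2]
  refine mul_le_mul_of_nonneg_right ?_ (by positivity)
  rw [div_le_div_iff₀ (by positivity) (by positivity)]
  calc ((28 ! : ℝ)) ^ 2 * E ^ 8 * 2 ^ 60 ≤ 2 ^ 196 * (2 ^ 11 * S) ^ 8 * 2 ^ 60 := by gcongr
    _ = S ^ 8 * (2 ^ 172 * 2 ^ 172) := by ring

/-! ## §2 The prefactors at the general step (`Λ = Λ_m`, `X₀ = 8`, dressing block `8δ`, door `1/128`) -/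

/-- `Λ_m = (4^m)⁻¹/32`. -/
private theorem klScale_eq' (m : ℕ) : (klScale klE0 m) = ((4 : ℝ) ^ m)⁻¹ / 32 := by
  simp only [klScale, klE0]; ring

/-- `0 < Λ_m`. -/
private theorem klScale_pos' (m : ℕ) : 0 < (klScale klE0 m) := by rw [klScale_eq']; positivity

/-- **`P_b = 48δ/Λ_m ≤ 12`** under `δ ≤ Λ_m/4`; and `0 ≤ P_b`. [cite: BenfattoGiulianiMastropietro2006, §2.3 (2.23)] -/
theorem genPrefB_le {R : RenConsts} (hR0 : 0 ≤ R.Gfr 0) {U Θ c : ℝ} (hc : c ≠ 0) (hΘ0 : 0 ≤ Θ) (m : ℕ)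
    (hδΛ : (R.Gfr 0 * |U| * Θ * ((16 : ℝ) ^ m)⁻¹) ≤ (klScale klE0 m) / 4) :
    (R.Gfr 0 * |U| * Θ * ((16 : ℝ) ^ m)⁻¹) / |c| * (8 * (|c| * (6 / (klScale klE0 m)))) ≤ 12 ∧
      0 ≤ (R.Gfr 0 * |U| * Θ * ((16 : ℝ) ^ m)⁻¹) / |c| * (8 * (|c| * (6 / (klScale klE0 m)))) := by
  have hΛ0 := klScale_pos' m
  have hca : 0 < |c| := abs_pos.2 hc
  have hδ0 : 0 ≤ (R.Gfr 0 * |U| * Θ * ((16 : ℝ) ^ m)⁻¹) := mul_nonneg (mul_nonneg (mul_nonneg hR0 (abs_nonneg U)) hΘ0) (by positivity)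
  have heq : (R.Gfr 0 * |U| * Θ * ((16 : ℝ) ^ m)⁻¹) / |c| * (8 * (|c| * (6 / (klScale klE0 m)))) =
      48 * ((R.Gfr 0 * |U| * Θ * ((16 : ℝ) ^ m)⁻¹) / (klScale klE0 m)) := by
    field_simp
    ring
  have hdq : (R.Gfr 0 * |U| * Θ * ((16 : ℝ) ^ m)⁻¹) / (klScale klE0 m) ≤ 1 / 4 := by rw [div_le_iff₀ hΛ0]; linarith
  have hdq0 : 0 ≤ (R.Gfr 0 * |U| * Θ * ((16 : ℝ) ^ m)⁻¹) / (klScale klE0 m) := div_nonneg hδ0 hΛ0.le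
  rw [heq]
  constructor <;> linarith

/-- **`P_a = 48δ²/Λ_m ≤ 3/32`** under `δ ≤ Λ_m/4` and `Gfr₀|U|Θ ≤ 1/128`; and `0 ≤ P_a`. [cite: BenfattoGiulianiMastropietro2006, §2.3 (2.23)] -/
theorem genPrefA_le {R : RenConsts} (hR0 : 0 ≤ R.Gfr 0) {U Θ c : ℝ} (hc : c ≠ 0) (hΘ0 : 0 ≤ Θ) (m : ℕ)
    (hδΛ : (R.Gfr 0 * |U| * Θ * ((16 : ℝ) ^ m)⁻¹) ≤ (klScale klE0 m) / 4) (hT : R.Gfr 0 * |U| * Θ ≤ 1 / 128) :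
    (R.Gfr 0 * |U| * Θ * ((16 : ℝ) ^ m)⁻¹) * (R.Gfr 0 * |U| * Θ * ((16 : ℝ) ^ m)⁻¹) / |c| * (8 * (|c| * (6 / (klScale klE0 m)))) ≤ 3 / 32 ∧
      0 ≤ (R.Gfr 0 * |U| * Θ * ((16 : ℝ) ^ m)⁻¹) * (R.Gfr 0 * |U| * Θ * ((16 : ℝ) ^ m)⁻¹) / |c| * (8 * (|c| * (6 / (klScale klE0 m)))) := by
  have hΛ0 := klScale_pos' m
  have hca : 0 < |c| := abs_pos.2 hc
  have hT0 : 0 ≤ R.Gfr 0 * |U| * Θ := mul_nonneg (mul_nonneg hR0 (abs_nonneg U)) hΘ0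
  have hδ0 : 0 ≤ (R.Gfr 0 * |U| * Θ * ((16 : ℝ) ^ m)⁻¹) := mul_nonneg hT0 (by positivity)
  have hδT : (R.Gfr 0 * |U| * Θ * ((16 : ℝ) ^ m)⁻¹) ≤ 1 / 128 := by
    have h16 : ((16 : ℝ) ^ m)⁻¹ ≤ 1 := inv_le_one_of_one_le₀ (one_le_pow₀ (by norm_num))
    calc (R.Gfr 0 * |U| * Θ * ((16 : ℝ) ^ m)⁻¹) ≤ R.Gfr 0 * |U| * Θ * 1 := mul_le_mul_of_nonneg_left h16 hT0
      _ ≤ 1 / 128 := by linarith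
  have heq : (R.Gfr 0 * |U| * Θ * ((16 : ℝ) ^ m)⁻¹) * (R.Gfr 0 * |U| * Θ * ((16 : ℝ) ^ m)⁻¹) / |c| * (8 * (|c| * (6 / (klScale klE0 m)))) =
      48 * (R.Gfr 0 * |U| * Θ * ((16 : ℝ) ^ m)⁻¹) * ((R.Gfr 0 * |U| * Θ * ((16 : ℝ) ^ m)⁻¹) / (klScale klE0 m)) := by
    field_simp
    ring
  have hdq : (R.Gfr 0 * |U| * Θ * ((16 : ℝ) ^ m)⁻¹) / (klScale klE0 m) ≤ 1 / 4 := by rw [div_le_iff₀ hΛ0]; linarith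
  have hdq0 : 0 ≤ (R.Gfr 0 * |U| * Θ * ((16 : ℝ) ^ m)⁻¹) / (klScale klE0 m) := div_nonneg hδ0 hΛ0.le
  rw [heq]
  constructor
  · nlinarith [mul_nonneg hδ0 hdq0]
  · positivity

/-- **The tree prefactors**: `8(|c|·6/Λ_m) + 8(|c|·2/Λ_m) = 2^11·4^m·|c|`. -/
theorem genTreePref_eq (c : ℝ) (m : ℕ) :
    8 * (|c| * (6 / (klScale klE0 m))) + 8 * (|c| * (2 / (klScale klE0 m))) = 2 ^ 11 * (4 : ℝ) ^ m * |c| := by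
  have hinv : ((klScale klE0 m))⁻¹ = 32 * (4 : ℝ) ^ m := by
    rw [klScale_eq', inv_div, div_eq_mul_inv, inv_inv]
  simp only [div_eq_mul_inv, hinv]
  ring

/-! ## §3 The six pieces -/

/-- **Tree alias piece**: `2(2(X·(3ʲ·(P₆(28!)²ρ₁²⁸ + P₂(28!)²ρ₂²⁸)·r^{28−j−4}·S))) ≤ 2^27·4^m·Nj²·Q` from `X·(P₆+P₂) ≤ 2^12·4^m·Nj²`.
[cite: BenfattoGiulianiMastropietro2006, §2.3 (2.24)] -/
theorem genTreeAlias_le {X P6 P2 ρ₁ ρ₂ r S ε B Q Nj : ℝ} {m j : ℕ} (hj : j ≤ 4) (hX0 : 0 ≤ X) (hP6 : 0 ≤ P6) (hP2 : 0 ≤ P2)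
    (hXP : X * (P6 + P2) ≤ 2 ^ 12 * (4 : ℝ) ^ m * Nj ^ 2) (hρ10 : 0 ≤ ρ₁) (hρ20 : 0 ≤ ρ₂) (hr0 : 0 ≤ r) (hr1 : r ≤ 1)
    (hρ1r : ρ₁ * r ≤ ε) (hρ1B : ρ₁ ≤ B) (hρ2r : ρ₂ * r ≤ ε) (hρ2B : ρ₂ ≤ B) (hS0 : 0 ≤ S) (hS : S ≤ 81)
    (hQ : ((28 ! : ℝ)) ^ 2 * B ^ 8 * ε ^ 20 ≤ Q) :
    2 * (2 * (X * ((3 : ℝ) ^ j * (P6 * ((28 ! : ℝ)) ^ 2 * ρ₁ ^ 28 + P2 * ((28 ! : ℝ)) ^ 2 * ρ₂ ^ 28) * r ^ (28 - j - 4) * S))) ≤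
      2 ^ 27 * (4 : ℝ) ^ m * Nj ^ 2 * Q := by
  have h3 : (3 : ℝ) ^ j ≤ 81 := by
    calc (3 : ℝ) ^ j ≤ 3 ^ 4 := pow_le_pow_right₀ (by norm_num) hj
      _ = 81 := by norm_num
  have hB0 : 0 ≤ B := hρ10.trans hρ1B
  have hε0 : 0 ≤ ε := (mul_nonneg hρ10 hr0).trans hρ1r
  have hT1 := aliasTerm28_le hP6 hρ10 hr0 hr1 hρ1r hρ1B hj
  have hT2 := aliasTerm28_le hP2 hρ20 hr0 hr1 hρ2r hρ2B hj
  have hQ0 : 0 ≤ ((28 ! : ℝ)) ^ 2 * B ^ 8 * ε ^ 20 := by positivity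
  have hD : (P6 * ((28 ! : ℝ)) ^ 2 * ρ₁ ^ 28 + P2 * ((28 ! : ℝ)) ^ 2 * ρ₂ ^ 28) * r ^ (28 - j - 4) ≤ (P6 + P2) * Q := by
    calc (P6 * ((28 ! : ℝ)) ^ 2 * ρ₁ ^ 28 + P2 * ((28 ! : ℝ)) ^ 2 * ρ₂ ^ 28) * r ^ (28 - j - 4)
        = P6 * ((28 ! : ℝ)) ^ 2 * ρ₁ ^ 28 * r ^ (28 - j - 4) + P2 * ((28 ! : ℝ)) ^ 2 * ρ₂ ^ 28 * r ^ (28 - j - 4) := by ring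
      _ ≤ P6 * ((28 ! : ℝ)) ^ 2 * B ^ 8 * ε ^ 20 + P2 * ((28 ! : ℝ)) ^ 2 * B ^ 8 * ε ^ 20 := add_le_add hT1 hT2
      _ = (P6 + P2) * (((28 ! : ℝ)) ^ 2 * B ^ 8 * ε ^ 20) := by ring
      _ ≤ (P6 + P2) * Q := mul_le_mul_of_nonneg_left hQ (add_nonneg hP6 hP2)
  have hD0 : 0 ≤ (P6 * ((28 ! : ℝ)) ^ 2 * ρ₁ ^ 28 + P2 * ((28 ! : ℝ)) ^ 2 * ρ₂ ^ 28) * r ^ (28 - j - 4) := by positivity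
  have hQ' : 0 ≤ Q := hQ0.trans hQ
  have h81 : (3 : ℝ) ^ j * S ≤ 81 * 81 := mul_le_mul h3 hS hS0 (by norm_num)
  have hm := mul_le_mul h81 hD hD0 (by norm_num)
  have hm0 : 0 ≤ ((3 : ℝ) ^ j * S) * ((P6 * ((28 ! : ℝ)) ^ 2 * ρ₁ ^ 28 + P2 * ((28 ! : ℝ)) ^ 2 * ρ₂ ^ 28) * r ^ (28 - j - 4)) := by positivity
  have hXm := mul_le_mul_of_nonneg_left hm hX0
  calc 2 * (2 * (X * ((3 : ℝ) ^ j * (P6 * ((28 ! : ℝ)) ^ 2 * ρ₁ ^ 28 + P2 * ((28 ! : ℝ)) ^ 2 * ρ₂ ^ 28) * r ^ (28 - j - 4) * S)))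
      = 4 * (X * (((3 : ℝ) ^ j * S) * ((P6 * ((28 ! : ℝ)) ^ 2 * ρ₁ ^ 28 + P2 * ((28 ! : ℝ)) ^ 2 * ρ₂ ^ 28) * r ^ (28 - j - 4)))) := by ring
    _ ≤ 4 * (X * ((81 * 81) * ((P6 + P2) * Q))) := by linarith
    _ = 26244 * ((X * (P6 + P2)) * Q) := by ring
    _ ≤ 26244 * ((2 ^ 12 * (4 : ℝ) ^ m * Nj ^ 2) * Q) := by
        have := mul_le_mul_of_nonneg_right hXP hQ'
        linarith
    _ ≤ 2 ^ 27 * (4 : ℝ) ^ m * Nj ^ 2 * Q := by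
        have : 0 ≤ (4 : ℝ) ^ m * Nj ^ 2 * Q := by positivity
        nlinarith

/-- `0 ≤` the tree alias piece. -/
theorem genTreeAlias_nonneg {X P6 P2 ρ₁ ρ₂ r S : ℝ} (j : ℕ) (hX0 : 0 ≤ X) (hP6 : 0 ≤ P6) (hP2 : 0 ≤ P2) (hr0 : 0 ≤ r) (hS0 : 0 ≤ S) :
    0 ≤ 2 * (2 * (X * ((3 : ℝ) ^ j * (P6 * ((28 ! : ℝ)) ^ 2 * ρ₁ ^ 28 + P2 * ((28 ! : ℝ)) ^ 2 * ρ₂ ^ 28) * r ^ (28 - j - 4) * S))) := by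
  positivity

/-- **Tree far piece**: `L²Lʲ·((P₆(0!)²ρ₁⁰ + P₂(0!)²ρ₂⁰)·(X′/(1+L/4)^s)) ≤ 2^24·4^m·Ns²·Xv⁴` from `(P₆+P₂)·X′ ≤ 2^12·4^m·Ns²`, `4/L ≤ Xv`, `10 ≤ s`, `4 ≤ L`.
[cite: BenfattoGiulianiMastropietro2006, §2.3 (2.24)] -/
theorem genTreeFar_le {L : ℕ} (hL4 : 4 ≤ L) {P6 P2 ρ₁ ρ₂ X' Xv Ns : ℝ} {m j s : ℕ} (hj : j ≤ 4) (hs : 10 ≤ s) (hP6 : 0 ≤ P6) (hP2 : 0 ≤ P2)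
    (hX'0 : 0 ≤ X') (hPX : (P6 + P2) * X' ≤ 2 ^ 12 * (4 : ℝ) ^ m * Ns ^ 2) (h4L : 4 / (L : ℝ) ≤ Xv) :
    (L : ℝ) ^ 2 * (L : ℝ) ^ j * ((P6 * ((0 ! : ℝ)) ^ 2 * ρ₁ ^ 0 + P2 * ((0 ! : ℝ)) ^ 2 * ρ₂ ^ 0) * (X' / (1 + (L : ℝ) / 4) ^ s)) ≤
      2 ^ 24 * (4 : ℝ) ^ m * Ns ^ 2 * Xv ^ 4 := by
  have hLr : (4 : ℝ) ≤ L := by exact_mod_cast hL4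
  have hLpos : (0 : ℝ) < L := by linarith
  have hq1 : 4 / (L : ℝ) ≤ 1 := by rw [div_le_one hLpos]; exact hLr
  have hq0 : 0 ≤ 4 / (L : ℝ) := by positivity
  have hA : P6 * ((0 ! : ℝ)) ^ 2 * ρ₁ ^ 0 + P2 * ((0 ! : ℝ)) ^ 2 * ρ₂ ^ 0 = P6 + P2 := by simp [Nat.factorial]
  rw [hA]
  have h := far_weight_le hL4 (add_nonneg hP6 hP2) hX'0 hj (show 6 ≤ s by omega)
  have hpow : (4 / (L : ℝ)) ^ (s - 6) ≤ Xv ^ 4 :=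
    (pow_le_pow_of_le_one hq0 hq1 (show 4 ≤ s - 6 by omega)).trans (pow_le_pow_left₀ hq0 h4L 4)
  have hXv0 : 0 ≤ Xv ^ 4 := (pow_nonneg hq0 4).trans (pow_le_pow_left₀ hq0 h4L 4)
  calc (L : ℝ) ^ 2 * (L : ℝ) ^ j * ((P6 + P2) * (X' / (1 + (L : ℝ) / 4) ^ s)) ≤ (P6 + P2) * X' * 4 ^ 6 * (4 / (L : ℝ)) ^ (s - 6) := h
    _ ≤ (2 ^ 12 * (4 : ℝ) ^ m * Ns ^ 2) * 4 ^ 6 * Xv ^ 4 := by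
        have h1 : (P6 + P2) * X' * 4 ^ 6 ≤ (2 ^ 12 * (4 : ℝ) ^ m * Ns ^ 2) * 4 ^ 6 := mul_le_mul_of_nonneg_right hPX (by norm_num)
        exact mul_le_mul h1 hpow (by positivity) (by positivity)
    _ = 2 ^ 24 * (4 : ℝ) ^ m * Ns ^ 2 * Xv ^ 4 := by ring

/-- `0 ≤` the tree far piece. -/
theorem genTreeFar_nonneg (L : ℕ) {P6 P2 ρ₁ ρ₂ X' : ℝ} (j s : ℕ) (hP6 : 0 ≤ P6) (hP2 : 0 ≤ P2) (hX'0 : 0 ≤ X') :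
    0 ≤ (L : ℝ) ^ 2 * (L : ℝ) ^ j * ((P6 * ((0 ! : ℝ)) ^ 2 * ρ₁ ^ 0 + P2 * ((0 ! : ℝ)) ^ 2 * ρ₂ ^ 0) * (X' / (1 + (L : ℝ) / 4) ^ s)) := by
  positivity

/-- **Dressing `a` alias piece**: `2(2((1/4)·(3ʲ·(P_a(28!)²ρ²⁸)·r^{28−j−4}·S))) ≤ 2^10·Q` (`P_a ≤ 3/32`). [cite: BenfattoGiulianiMastropietro2006, §2.3 (2.24)] -/
theorem genJaAlias_le {Pa ρ r S ε B Q : ℝ} {j : ℕ} (hj : j ≤ 4) (hPa0 : 0 ≤ Pa) (hPa : Pa ≤ 3 / 32) (hρ0 : 0 ≤ ρ) (hr0 : 0 ≤ r) (hr1 : r ≤ 1)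
    (hρr : ρ * r ≤ ε) (hρB : ρ ≤ B) (hS0 : 0 ≤ S) (hS : S ≤ 81) (hQ : ((28 ! : ℝ)) ^ 2 * B ^ 8 * ε ^ 20 ≤ Q) :
    2 * (2 * ((1 / 4 : ℝ) * ((3 : ℝ) ^ j * (Pa * ((28 ! : ℝ)) ^ 2 * ρ ^ 28) * r ^ (28 - j - 4) * S))) ≤ 2 ^ 10 * Q := by
  have h3 : (3 : ℝ) ^ j ≤ 81 := by
    calc (3 : ℝ) ^ j ≤ 3 ^ 4 := pow_le_pow_right₀ (by norm_num) hj
      _ = 81 := by norm_num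
  have hB0 : 0 ≤ B := hρ0.trans hρB
  have hε0 : 0 ≤ ε := (mul_nonneg hρ0 hr0).trans hρr
  have hT := aliasTerm28_le hPa0 hρ0 hr0 hr1 hρr hρB hj
  have hQ0 : 0 ≤ ((28 ! : ℝ)) ^ 2 * B ^ 8 * ε ^ 20 := by positivity
  have hPQ : Pa * ((28 ! : ℝ)) ^ 2 * B ^ 8 * ε ^ 20 ≤ 3 / 32 * Q := by
    calc Pa * ((28 ! : ℝ)) ^ 2 * B ^ 8 * ε ^ 20 = Pa * (((28 ! : ℝ)) ^ 2 * B ^ 8 * ε ^ 20) := by ring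
      _ ≤ 3 / 32 * Q := mul_le_mul hPa hQ hQ0 (by norm_num)
  have hX0 : 0 ≤ Pa * ((28 ! : ℝ)) ^ 2 * ρ ^ 28 * r ^ (28 - j - 4) := by positivity
  have h81 : (3 : ℝ) ^ j * S ≤ 81 * 81 := mul_le_mul h3 hS hS0 (by norm_num)
  have hm := mul_le_mul h81 (hT.trans hPQ) hX0 (by norm_num)
  have hQ' : 0 ≤ Q := by nlinarith
  calc 2 * (2 * ((1 / 4 : ℝ) * ((3 : ℝ) ^ j * (Pa * ((28 ! : ℝ)) ^ 2 * ρ ^ 28) * r ^ (28 - j - 4) * S)))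
      = ((3 : ℝ) ^ j * S) * (Pa * ((28 ! : ℝ)) ^ 2 * ρ ^ 28 * r ^ (28 - j - 4)) := by ring
    _ ≤ (81 * 81) * (3 / 32 * Q) := hm
    _ ≤ 2 ^ 10 * Q := by nlinarith

/-- `0 ≤` the dressing `a` alias piece. -/
theorem genJaAlias_nonneg {Pa ρ r S : ℝ} (j : ℕ) (hPa0 : 0 ≤ Pa) (hr0 : 0 ≤ r) (hS0 : 0 ≤ S) :
    0 ≤ 2 * (2 * ((1 / 4 : ℝ) * ((3 : ℝ) ^ j * (Pa * ((28 ! : ℝ)) ^ 2 * ρ ^ 28) * r ^ (28 - j - 4) * S))) := by positivity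

/-- **Dressing `a` far piece**: `L²Lʲ·((P_a(0!)²ρ⁰)·((1/4)/(1+L/4)^s)) ≤ 2^7·Xv⁴`. [cite: BenfattoGiulianiMastropietro2006, §2.3 (2.24)] -/
theorem genJaFar_le {L : ℕ} (hL4 : 4 ≤ L) {Pa ρ Xv : ℝ} (hPa0 : 0 ≤ Pa) (hPa : Pa ≤ 3 / 32) {j s : ℕ} (hj : j ≤ 4) (hs : 10 ≤ s)
    (h4L : 4 / (L : ℝ) ≤ Xv) :
    (L : ℝ) ^ 2 * (L : ℝ) ^ j * ((Pa * ((0 ! : ℝ)) ^ 2 * ρ ^ 0) * ((1 / 4 : ℝ) / (1 + (L : ℝ) / 4) ^ s)) ≤ 2 ^ 7 * Xv ^ 4 := by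
  have hLr : (4 : ℝ) ≤ L := by exact_mod_cast hL4
  have hLpos : (0 : ℝ) < L := by linarith
  have hq1 : 4 / (L : ℝ) ≤ 1 := by rw [div_le_one hLpos]; exact hLr
  have hq0 : 0 ≤ 4 / (L : ℝ) := by positivity
  have hA : Pa * ((0 ! : ℝ)) ^ 2 * ρ ^ 0 = Pa := by simp [Nat.factorial]
  rw [hA]
  have h := far_weight_le hL4 hPa0 (by norm_num : (0 : ℝ) ≤ 1 / 4) hj (show 6 ≤ s by omega)
  have hpow : (4 / (L : ℝ)) ^ (s - 6) ≤ Xv ^ 4 :=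
    (pow_le_pow_of_le_one hq0 hq1 (show 4 ≤ s - 6 by omega)).trans (pow_le_pow_left₀ hq0 h4L 4)
  have hXv0 : 0 ≤ Xv ^ 4 := (pow_nonneg hq0 4).trans (pow_le_pow_left₀ hq0 h4L 4)
  calc (L : ℝ) ^ 2 * (L : ℝ) ^ j * (Pa * ((1 / 4 : ℝ) / (1 + (L : ℝ) / 4) ^ s)) ≤ Pa * (1 / 4) * 4 ^ 6 * (4 / (L : ℝ)) ^ (s - 6) := h
    _ ≤ 3 / 32 * (1 / 4) * 4 ^ 6 * Xv ^ 4 := mul_le_mul (by nlinarith) hpow (by positivity) (by positivity)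
    _ ≤ 2 ^ 7 * Xv ^ 4 := by nlinarith

/-- `0 ≤` the dressing `a` far piece. -/
theorem genJaFar_nonneg (L : ℕ) {Pa ρ : ℝ} (hPa0 : 0 ≤ Pa) (j s : ℕ) :
    0 ≤ (L : ℝ) ^ 2 * (L : ℝ) ^ j * ((Pa * ((0 ! : ℝ)) ^ 2 * ρ ^ 0) * ((1 / 4 : ℝ) / (1 + (L : ℝ) / 4) ^ s)) := by positivity

/-- **Dressing `b` alias piece**: `2(2((1/4·Sj′)·(3ʲ·(P²(28!)²ρ₄²⁸ + 2(P(28!)²ρ₃²⁸))·r^{28−j−4}·S))) ≤ 2^21·Nj′·Q` (`P ≤ 12`, `0 ≤ Sj′ ≤ Nj′`).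
[cite: BenfattoGiulianiMastropietro2006, §2.3 (2.24)] -/
theorem genJbAlias_le {P ρ₃ ρ₄ r S ε B Q Sj' Nj' : ℝ} {j : ℕ} (hj : j ≤ 4) (hP0 : 0 ≤ P) (hP : P ≤ 12) (hρ30 : 0 ≤ ρ₃) (hρ40 : 0 ≤ ρ₄)
    (hr0 : 0 ≤ r) (hr1 : r ≤ 1) (hρ3r : ρ₃ * r ≤ ε) (hρ3B : ρ₃ ≤ B) (hρ4r : ρ₄ * r ≤ ε) (hρ4B : ρ₄ ≤ B) (hS0 : 0 ≤ S) (hS : S ≤ 81)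
    (hQ : ((28 ! : ℝ)) ^ 2 * B ^ 8 * ε ^ 20 ≤ Q) (hSj0 : 0 ≤ Sj') (hSj : Sj' ≤ Nj') :
    2 * (2 * ((1 / 4 * Sj') * ((3 : ℝ) ^ j * (P * P * ((28 ! : ℝ)) ^ 2 * ρ₄ ^ 28 + 2 * (P * ((28 ! : ℝ)) ^ 2 * ρ₃ ^ 28)) * r ^ (28 - j - 4) * S))) ≤
      2 ^ 21 * Nj' * Q := by
  have h3 : (3 : ℝ) ^ j ≤ 81 := by
    calc (3 : ℝ) ^ j ≤ 3 ^ 4 := pow_le_pow_right₀ (by norm_num) hj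
      _ = 81 := by norm_num
  have hB0 : 0 ≤ B := hρ30.trans hρ3B
  have hε0 : 0 ≤ ε := (mul_nonneg hρ30 hr0).trans hρ3r
  have hT4 := aliasTerm28_le (mul_nonneg hP0 hP0) hρ40 hr0 hr1 hρ4r hρ4B hj
  have hT3 := aliasTerm28_le hP0 hρ30 hr0 hr1 hρ3r hρ3B hj
  have hQ0 : 0 ≤ ((28 ! : ℝ)) ^ 2 * B ^ 8 * ε ^ 20 := by positivity
  have hPP : P * P + 2 * P ≤ 168 := by nlinarith
  have hD : (P * P * ((28 ! : ℝ)) ^ 2 * ρ₄ ^ 28 + 2 * (P * ((28 ! : ℝ)) ^ 2 * ρ₃ ^ 28)) * r ^ (28 - j - 4) ≤ 168 * Q := by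
    calc (P * P * ((28 ! : ℝ)) ^ 2 * ρ₄ ^ 28 + 2 * (P * ((28 ! : ℝ)) ^ 2 * ρ₃ ^ 28)) * r ^ (28 - j - 4)
        = P * P * ((28 ! : ℝ)) ^ 2 * ρ₄ ^ 28 * r ^ (28 - j - 4) + 2 * (P * ((28 ! : ℝ)) ^ 2 * ρ₃ ^ 28 * r ^ (28 - j - 4)) := by ring
      _ ≤ P * P * ((28 ! : ℝ)) ^ 2 * B ^ 8 * ε ^ 20 + 2 * (P * ((28 ! : ℝ)) ^ 2 * B ^ 8 * ε ^ 20) := by linarith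
      _ = (P * P + 2 * P) * (((28 ! : ℝ)) ^ 2 * B ^ 8 * ε ^ 20) := by ring
      _ ≤ 168 * Q := mul_le_mul hPP hQ hQ0 (by norm_num)
  have hD0 : 0 ≤ (P * P * ((28 ! : ℝ)) ^ 2 * ρ₄ ^ 28 + 2 * (P * ((28 ! : ℝ)) ^ 2 * ρ₃ ^ 28)) * r ^ (28 - j - 4) := by positivity
  have hQ' : 0 ≤ Q := by nlinarith
  have h81 : (3 : ℝ) ^ j * S ≤ 81 * 81 := mul_le_mul h3 hS hS0 (by norm_num)
  have hm := mul_le_mul h81 hD hD0 (by norm_num)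
  have hm0 : 0 ≤ ((3 : ℝ) ^ j * S) * ((P * P * ((28 ! : ℝ)) ^ 2 * ρ₄ ^ 28 + 2 * (P * ((28 ! : ℝ)) ^ 2 * ρ₃ ^ 28)) * r ^ (28 - j - 4)) := by positivity
  have hN0 : 0 ≤ Nj' := hSj0.trans hSj
  calc 2 * (2 * ((1 / 4 * Sj') * ((3 : ℝ) ^ j * (P * P * ((28 ! : ℝ)) ^ 2 * ρ₄ ^ 28 + 2 * (P * ((28 ! : ℝ)) ^ 2 * ρ₃ ^ 28)) * r ^ (28 - j - 4) * S)))
      = Sj' * (((3 : ℝ) ^ j * S) * ((P * P * ((28 ! : ℝ)) ^ 2 * ρ₄ ^ 28 + 2 * (P * ((28 ! : ℝ)) ^ 2 * ρ₃ ^ 28)) * r ^ (28 - j - 4))) := by ring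
    _ ≤ Nj' * ((81 * 81) * (168 * Q)) := mul_le_mul hSj hm hm0 hN0
    _ ≤ 2 ^ 21 * Nj' * Q := by nlinarith [mul_nonneg hN0 hQ']

/-- `0 ≤` the dressing `b` alias piece. -/
theorem genJbAlias_nonneg {P ρ₃ ρ₄ r S Sj' : ℝ} (j : ℕ) (hP0 : 0 ≤ P) (hr0 : 0 ≤ r) (hS0 : 0 ≤ S) (hSj0 : 0 ≤ Sj') :
    0 ≤ 2 * (2 * ((1 / 4 * Sj') * ((3 : ℝ) ^ j * (P * P * ((28 ! : ℝ)) ^ 2 * ρ₄ ^ 28 + 2 * (P * ((28 ! : ℝ)) ^ 2 * ρ₃ ^ 28)) * r ^ (28 - j - 4) * S))) := by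
  positivity

/-- **Dressing `b` far piece**: `L²Lʲ·((P²(0!)²ρ₄⁰ + 2(P(0!)²ρ₃⁰))·((1/4·Ss′)/(1+L/4)^s)) ≤ 2^18·Ns′·Xv⁴` (`P ≤ 12`, `0 ≤ Ss′ ≤ Ns′`).
[cite: BenfattoGiulianiMastropietro2006, §2.3 (2.24)] -/
theorem genJbFar_le {L : ℕ} (hL4 : 4 ≤ L) {P ρ₃ ρ₄ Xv Ss' Ns' : ℝ} (hP0 : 0 ≤ P) (hP : P ≤ 12) (hSs0 : 0 ≤ Ss') (hSs : Ss' ≤ Ns') {j s : ℕ}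
    (hj : j ≤ 4) (hs : 10 ≤ s) (h4L : 4 / (L : ℝ) ≤ Xv) :
    (L : ℝ) ^ 2 * (L : ℝ) ^ j * ((P * P * ((0 ! : ℝ)) ^ 2 * ρ₄ ^ 0 + 2 * (P * ((0 ! : ℝ)) ^ 2 * ρ₃ ^ 0)) * ((1 / 4 * Ss') / (1 + (L : ℝ) / 4) ^ s)) ≤
      2 ^ 18 * Ns' * Xv ^ 4 := by
  have hLr : (4 : ℝ) ≤ L := by exact_mod_cast hL4
  have hLpos : (0 : ℝ) < L := by linarith
  have hq1 : 4 / (L : ℝ) ≤ 1 := by rw [div_le_one hLpos]; exact hLr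
  have hq0 : 0 ≤ 4 / (L : ℝ) := by positivity
  have hA : P * P * ((0 ! : ℝ)) ^ 2 * ρ₄ ^ 0 + 2 * (P * ((0 ! : ℝ)) ^ 2 * ρ₃ ^ 0) = P * P + 2 * P := by simp [Nat.factorial]
  rw [hA]
  have hPP0 : 0 ≤ P * P + 2 * P := by positivity
  have hPP : P * P + 2 * P ≤ 168 := by nlinarith
  have hM0 : 0 ≤ 1 / 4 * Ss' := by positivity
  have h := far_weight_le hL4 hPP0 hM0 hj (show 6 ≤ s by omega)
  have hpow : (4 / (L : ℝ)) ^ (s - 6) ≤ Xv ^ 4 :=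
    (pow_le_pow_of_le_one hq0 hq1 (show 4 ≤ s - 6 by omega)).trans (pow_le_pow_left₀ hq0 h4L 4)
  have hXv0 : 0 ≤ Xv ^ 4 := (pow_nonneg hq0 4).trans (pow_le_pow_left₀ hq0 h4L 4)
  have hN0 : 0 ≤ Ns' := hSs0.trans hSs
  calc (L : ℝ) ^ 2 * (L : ℝ) ^ j * ((P * P + 2 * P) * ((1 / 4 * Ss') / (1 + (L : ℝ) / 4) ^ s))
      ≤ (P * P + 2 * P) * (1 / 4 * Ss') * 4 ^ 6 * (4 / (L : ℝ)) ^ (s - 6) := h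
    _ ≤ 168 * (1 / 4 * Ns') * 4 ^ 6 * Xv ^ 4 :=
        mul_le_mul (mul_le_mul_of_nonneg_right (mul_le_mul hPP (by linarith) hM0 (by norm_num)) (by norm_num)) hpow (by positivity) (by positivity)
    _ ≤ 2 ^ 18 * Ns' * Xv ^ 4 := by nlinarith [mul_nonneg hN0 hXv0]

/-- `0 ≤` the dressing `b` far piece. -/
theorem genJbFar_nonneg (L : ℕ) {P ρ₃ ρ₄ Ss' : ℝ} (hP0 : 0 ≤ P) (hSs0 : 0 ≤ Ss') (j s : ℕ) :
    0 ≤ (L : ℝ) ^ 2 * (L : ℝ) ^ j * ((P * P * ((0 ! : ℝ)) ^ 2 * ρ₄ ^ 0 + 2 * (P * ((0 ! : ℝ)) ^ 2 * ρ₃ ^ 0)) * ((1 / 4 * Ss') / (1 + (L : ℝ) / 4) ^ s)) := by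
  positivity

end Summit.HubbardSuperconductivity.HubbardSuperconductivity.Theorems.EngineV8

end
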